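import Literature.Computability.AlgebraicComplexity.IMMSubstDerivatives
import Literature.Computability.AlgebraicComplexity.IMMStarLayout
import HarnessLib

/-!
# The support of `∂_α ρ_{J,V} IMM` in the block layout of `IMM^*` (Kumar–Saraf 2017, §8.1, §8.3,
Lemma 8.3)

Topic `Literature/Computability/AlgebraicComplexity`; infrastructure for the printed proof of
`kumarSaraf2017_imm_homDepthFour` (`HomogeneousDepthFour.lean`), Step 2–3 of the roadmap. For the
layout of `IMMStarLayout.lean` (`d = r (k+2) + e` matrices: `r` blocks `Y X_0 ⋯ X_{k-1} J`, then
`e` identity layers) we define, in the variables `Fin d × Fin ñ × Fin ñ` of the tree's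
`immPoly ñ d`,

* `Jset` — the variables set to `1`: all entries of the `J` layers and the diagonal entries of the
  identity layers (`ρ_{J,V}` turns the `J` layers into all-ones matrices and the trailing layers
  into identity matrices);
* `Vset S ξ` — the variables kept: the entries `(0, c)`, `c ∈ S b`, of the special matrix `Y` of
  block `b` ("`ñ^{3/4}` entries … from the first row", [KS, §8.3]) and the entries `(u, c)`,
  `c ∈ ξ b (j, u)`, of the regular matrix `X_j` of block `b`;
* `Lalpha α` — the derivative operator of the transversal `α` (one kept `Y`-entry per block).

Main results:

* **`mem_derivWalks_iff_goodWalk`** — for `r ≥ 1` and `α b ∈ S b`, the alive closed walks through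
  `α` (`IMMWalk.derivWalks`, `IMMSubstDerivatives.lean`) are exactly the good walks
  (`KumarSaraf.GoodWalk`, `IMMStarLayout.lean`);
* **`eraseVars_injOn_aliveWalks`** — recoverability: an alive closed walk is determined by its
  non-`Jset` variables (a `J`-step leads to the row `0` of the next `Y`, the identity layers keep the
  walk at `0`), the hypothesis of `IMMWalk.mem_support_deriv_iff`;
* **`card_support_deriv_immStar`** — [KS, Lemma 8.3] ("for all `V`"): the support of
  `∂_α ρ_{J,V} IMM` has exactly `(∏_j deg_j)^r` elements when every row of `X_j` keeps `deg_j`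
  entries.

Everything is proved; no named facts.

## References

* M. Kumar, S. Saraf, *On the power of homogeneous depth 4 arithmetic circuits*, SIAM J. Comput.
  46 (2017) 336–387 (arXiv:1404.1950): §8.1, §8.3, Lemma 8.3.
-/

noncomputable section

namespace Literature.Computability.AlgebraicComplexity.KumarSaraf

open Finset IMMWalk

variable {r k e N : ℕ} (hN : 0 < N)

/-! ### The successor of a position -/

/-- The number of matrices is positive as soon as there is a block. [folklore] -/
theorem nL_pos (hr : 0 < r) : 0 < nL r k e := by unfold nL; nlinarith

/-- The successor position, on values. [folklore] -/
theorem val_finRotate_nL (hr : 0 < r) (t : Fin (nL r k e)) :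
    ((finRotate (nL r k e) t : Fin (nL r k e)) : ℕ) =
      if (t : ℕ) + 1 < nL r k e then (t : ℕ) + 1 else 0 :=
  val_finRotate (nL_pos hr) t

/-- After `Y` comes `X_0`. [folklore] -/
theorem finRotate_posY (hr : 0 < r) (b : Fin r) :
    finRotate (nL r k e) (posY b) = posX (e := e) b 0 := by
  apply Fin.ext
  rw [val_finRotate_nL hr, posY_val, posX_val, if_pos]
  · simp
  · have := b.2; unfold nL; nlinarith

/-- After the `j`-th vertex of the regular part comes the next one. [folklore] -/
theorem finRotate_posX_castSucc (hr : 0 < r) (b : Fin r) (j : Fin k) :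
    finRotate (nL r k e) (posX b j.castSucc) = posX (e := e) b j.succ := by
  apply Fin.ext
  rw [val_finRotate_nL hr, posX_val, posX_val, if_pos]
  · simp only [Fin.val_succ, Fin.val_castSucc]; omega
  · have := b.2; have := j.2; unfold nL; simp; nlinarith

/-! ### The substitution data of `IMM^*` -/

/-- **The variables set to `1`**: the `J` layers (all-ones matrices) and the diagonals of the
trailing identity layers. [cite: KumarSaraf2017, §8.1] -/
def Jset : Finset (Fin (nL r k e) × Fin N × Fin N) :=
  univ.filter fun x => (∃ b : Fin r, x.1 = posX b (Fin.last k)) ∨ (r * (k + 2) ≤ (x.1 : ℕ) ∧ x.2.1 = x.2.2)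

/-- **The variables kept**: the chosen first-row entries of the special matrices and the chosen
entries of every row of the regular matrices. [cite: KumarSaraf2017, §8.3] -/
def Vset (S : Fin r → Finset (Fin N)) (ξ : Fin r → Fin k × Fin N → Finset (Fin N)) :
    Finset (Fin (nL r k e) × Fin N × Fin N) :=
  univ.filter fun x => (∃ b : Fin r, x.1 = posY b ∧ x.2.1 = v0 hN ∧ x.2.2 ∈ S b) ∨
    (∃ (b : Fin r) (j : Fin k), x.1 = posX b j.castSucc ∧ x.2.2 ∈ ξ b (j, x.2.1))

/-- **The derivative operator of a transversal `α`**: the kept `Y`-entry `(0, α b)` of every block.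
[cite: KumarSaraf2017, §8.4] -/
def Lalpha (α : Fin r → Fin N) : List (Fin (nL r k e) × Fin N × Fin N) :=
  List.ofFn fun b : Fin r => (posY b, v0 hN, α b)

/-- The transversal operator has no duplicates. [folklore] -/
theorem nodup_Lalpha (α : Fin r → Fin N) : (Lalpha (k := k) (e := e) hN α).Nodup := by
  rw [Lalpha, List.nodup_ofFn]
  intro b b' h
  have := congrArg (fun x => ((x.1 : Fin (nL r k e)) : ℕ)) h
  simp only [posY_val] at this
  exact Fin.ext (Nat.eq_of_mul_eq_mul_right (by omega) this)

/-- The length of the transversal operator. [folklore] -/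
@[simp] theorem length_Lalpha (α : Fin r → Fin N) : (Lalpha (k := k) (e := e) hN α).length = r := by
  rw [Lalpha, List.length_ofFn]

/-! ### Layer types -/

/-- A `Y` position is not a `J` position. [folklore] -/
theorem posY_ne_posJ (b b' : Fin r) : (posY (k := k) (e := e) b : Fin (nL r k e)) ≠ posX b' (Fin.last k) := by
  intro h
  have := congrArg Fin.val h
  rw [posY_val, posX_val, Fin.val_last] at this
  have h2 := pos_inj (k := k) (b := b) (b' := b') (i := 0) (i' := 1 + k) (by omega) (by omega) (by omega)
  omega

/-- An `X` position (source of a regular layer) is not a `J` position. [folklore] -/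
theorem posX_castSucc_ne_posJ (b b' : Fin r) (j : Fin k) :
    (posX (e := e) b j.castSucc : Fin (nL r k e)) ≠ posX b' (Fin.last k) := by
  intro h
  have := congrArg Fin.val h
  rw [posX_val, posX_val, Fin.val_last, Fin.val_castSucc] at this
  have hj := j.2
  have h2 := pos_inj (k := k) (b := b) (b' := b') (i := 1 + j) (i' := 1 + k) (by omega) (by omega) (by omega)
  omega

/-- An `X` position is not a `Y` position. [folklore] -/
theorem posX_castSucc_ne_posY (b b' : Fin r) (j : Fin k) :
    (posX (e := e) b j.castSucc : Fin (nL r k e)) ≠ posY b' := by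
  intro h
  have := congrArg Fin.val h
  rw [posX_val, posY_val, Fin.val_castSucc] at this
  have hj := j.2
  have h2 := pos_inj (k := k) (b := b) (b' := b') (i := 1 + j) (i' := 0) (by omega) (by omega) (by omega)
  omega

/-- `posX` is injective in the block and the offset. [folklore] -/
theorem posX_castSucc_inj {b b' : Fin r} {j j' : Fin k}
    (h : (posX (e := e) b j.castSucc : Fin (nL r k e)) = posX b' j'.castSucc) : b = b' ∧ j = j' := by
  have := congrArg Fin.val h
  rw [posX_val, posX_val, Fin.val_castSucc, Fin.val_castSucc] at this
  have hj := j.2; have hj' := j'.2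
  have h2 := pos_inj (k := k) (b := b) (b' := b') (i := 1 + j) (i' := 1 + j') (by omega) (by omega) (by omega)
  exact ⟨Fin.ext h2.1, Fin.ext (by omega)⟩

/-- `posY` is injective. [folklore] -/
theorem posY_inj {b b' : Fin r} (h : (posY (k := k) (e := e) b : Fin (nL r k e)) = posY b') : b = b' := by
  have := congrArg Fin.val h
  rw [posY_val, posY_val] at this
  exact Fin.ext (Nat.eq_of_mul_eq_mul_right (by omega) this)

/-- Block positions have small values. [folklore] -/
theorem posX_val_lt (b : Fin r) (i : Fin (k + 1)) : ((posX (e := e) b i : Fin (nL r k e)) : ℕ) < r * (k + 2) := by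
  rw [posX_val]; have := b.2; have := i.2; nlinarith

/-- Block positions have small values. [folklore] -/
theorem posY_val_lt (b : Fin r) : ((posY (k := k) (e := e) b : Fin (nL r k e)) : ℕ) < r * (k + 2) := by
  rw [posY_val]; have := b.2; nlinarith

/-! ### The identity stretch -/

/-- If a closed walk takes diagonal steps on the identity layers, it sits at its initial vertex
there. [folklore] -/
theorem eq_of_identity_steps (hr : 0 < r) (v : Fin (nL r k e) → Fin N)
    (h : ∀ t : Fin (nL r k e), r * (k + 2) ≤ (t : ℕ) → v t = v (finRotate _ t)) :
    ∀ t : Fin (nL r k e), r * (k + 2) ≤ (t : ℕ) → v t = v ⟨0, nL_pos hr⟩ := by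
  have hd := nL_pos (k := k) (e := e) hr
  -- downward induction from the last position
  have key : ∀ i : ℕ, ∀ hi : i < nL r k e, r * (k + 2) ≤ nL r k e - 1 - i →
      v ⟨nL r k e - 1 - i, by omega⟩ = v ⟨0, hd⟩ := by
    intro i
    induction i with
    | zero =>
      intro hi hle
      rw [h _ hle]
      congr 1
      apply Fin.ext
      rw [val_finRotate_nL hr, if_neg (by simp; omega)]
    | succ i ih =>
      intro hi hle
      rw [h _ hle]
      have hval : ((finRotate (nL r k e) ⟨nL r k e - 1 - (i + 1), by omega⟩ : Fin (nL r k e)) : ℕ) =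
          nL r k e - 1 - i := by
        rw [val_finRotate_nL hr, if_pos (by simp; omega)]
        simp; omega
      have : finRotate (nL r k e) ⟨nL r k e - 1 - (i + 1), by omega⟩ = ⟨nL r k e - 1 - i, by omega⟩ :=
        Fin.ext hval
      rw [this]
      exact ih (by omega) (by omega)
  intro t ht
  have := key (nL r k e - 1 - t) (by omega) (by omega)
  have e1 : (⟨nL r k e - 1 - (nL r k e - 1 - (t : ℕ)), by omega⟩ : Fin (nL r k e)) = t :=
    Fin.ext (by simp; omega)
  rwa [e1] at this

/-! ### Good walks are the alive walks through `α` -/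

/-- Membership in the support of a closed-walk exponent vector. [folklore] -/
theorem mem_support_closedWalkExp_iff {d : ℕ} (v : Fin d → Fin N) (x : Fin d × Fin N × Fin N) :
    x ∈ (closedWalkExp v).support ↔ x = (x.1, v x.1, v (finRotate d x.1)) := by
  rw [Finsupp.mem_support_iff, closedWalkExp_apply]
  constructor
  · intro h
    by_contra hne
    exact h (if_neg hne)
  · intro h
    rw [if_pos h]
    exact one_ne_zero

/-- **The alive closed walks through `α` are exactly the good walks** (for `r ≥ 1` and a
transversal of kept `Y`-entries). [cite: KumarSaraf2017, §8.1] -/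
theorem mem_derivWalks_iff_goodWalk (hr : 0 < r) (S : Fin r → Finset (Fin N))
    (ξ : Fin r → Fin k × Fin N → Finset (Fin N)) (α : Fin r → Fin N) (hα : ∀ b, α b ∈ S b)
    (v : Fin (nL r k e) → Fin N) :
    v ∈ derivWalks (Jset (N := N)) (Vset hN S ξ) (Lalpha hN α) ↔ GoodWalk (e := e) hN ξ α v := by
  classical
  have hd := nL_pos (k := k) (e := e) hr
  constructor
  · intro hv
    rw [derivWalks, mem_filter, aliveWalks, mem_filter] at hv
    obtain ⟨⟨-, halive⟩, hthrough⟩ := hv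
    -- (G1) from passing through `α`
    have hG1 : ∀ b : Fin r, v (posY b) = v0 hN ∧ v (posX b 0) = α b := by
      intro b
      have hx := hthrough (posY b, v0 hN, α b) (by rw [Lalpha, List.mem_ofFn]; exact ⟨b, rfl⟩)
      rw [support_eraseVars, mem_sdiff, mem_support_closedWalkExp_iff] at hx
      have h1 := hx.1
      simp only [Prod.mk.injEq, true_and] at h1
      rw [finRotate_posY hr] at h1
      exact ⟨h1.1.symm, h1.2.symm⟩
    -- the variable of layer `t`
    have hvar : ∀ t : Fin (nL r k e), ((t, v t, v (finRotate _ t)) : Fin (nL r k e) × Fin N × Fin N)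
        ∈ (closedWalkExp v).support := fun t => (mem_support_closedWalkExp_iff v _).2 rfl
    refine ⟨hG1, fun b j => ?_, ?_⟩
    · -- (G2): the `X_j` variable is kept
      have hx := hvar (posX b j.castSucc)
      have hnJ : ((posX (e := e) b j.castSucc, v (posX b j.castSucc), v (finRotate _ (posX b j.castSucc)))
          : Fin (nL r k e) × Fin N × Fin N) ∉ Jset (N := N) := by
        rw [Jset, mem_filter, not_and_or]
        right
        push Not
        refine ⟨fun b' => posX_castSucc_ne_posJ b b' j, fun hle => absurd hle ?_⟩
        exact not_le.2 (posX_val_lt b j.castSucc)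
      have hV := halive (mem_sdiff.2 ⟨hx, hnJ⟩)
      rw [Vset, mem_filter] at hV
      rcases hV.2 with ⟨b', hb', -, -⟩ | ⟨b', j', hpos, hmem⟩
      · exact absurd hb' (posX_castSucc_ne_posY b b' j)
      · obtain ⟨rfl, rfl⟩ := posX_castSucc_inj hpos
        rw [finRotate_posX_castSucc hr] at hmem
        exact hmem
    · -- (G3): identity layers take diagonal steps, hence sit at `v 0 = 0`
      have hdiag : ∀ t : Fin (nL r k e), r * (k + 2) ≤ (t : ℕ) → v t = v (finRotate _ t) := by
        intro t ht
        by_contra hne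
        have hnJ : ((t, v t, v (finRotate _ t)) : Fin (nL r k e) × Fin N × Fin N) ∉ Jset (N := N) := by
          rw [Jset, mem_filter, not_and_or]
          right; push Not
          refine ⟨fun b' h => ?_, fun _ => hne⟩
          have h1 : (t : ℕ) = ((posX (e := e) b' (Fin.last k) : Fin (nL r k e)) : ℕ) :=
            congrArg Fin.val h
          have h2 := posX_val_lt (e := e) b' (Fin.last k)
          omega
        have hV := halive (mem_sdiff.2 ⟨hvar t, hnJ⟩)
        rw [Vset, mem_filter] at hV
        rcases hV.2 with ⟨b', hb', -, -⟩ | ⟨b', j', hpos, -⟩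
        · have h1 : (t : ℕ) = ((posY (k := k) (e := e) b' : Fin (nL r k e)) : ℕ) := congrArg Fin.val hb'
          have h2 := posY_val_lt (k := k) (e := e) b'
          omega
        · have h1 : (t : ℕ) = ((posX (e := e) b' j'.castSucc : Fin (nL r k e)) : ℕ) :=
            congrArg Fin.val hpos
          have h2 := posX_val_lt (e := e) b' j'.castSucc
          omega
      intro t ht
      rw [eq_of_identity_steps hr v hdiag t ht]
      have h0 : (⟨0, hd⟩ : Fin (nL r k e)) = posY ⟨0, hr⟩ := Fin.ext (by simp)
      rw [h0]; exact (hG1 _).1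
  · rintro ⟨hG1, hG2, hG3⟩
    rw [derivWalks, mem_filter, aliveWalks, mem_filter]
    refine ⟨⟨mem_univ _, fun x hx => ?_⟩, fun x hx => ?_⟩
    · -- alive
      rw [mem_sdiff, mem_support_closedWalkExp_iff] at hx
      obtain ⟨hxeq, hxJ⟩ := hx
      set t := x.1 with ht
      rw [hxeq] at hxJ ⊢
      rw [Vset, mem_filter]
      refine ⟨mem_univ _, ?_⟩
      dsimp only
      by_cases hlt : (t : ℕ) < r * (k + 2)
      · obtain ⟨hb, heq, hi⟩ := div_mod_of_lt hlt
        set b : Fin r := ⟨(t : ℕ) / (k + 2), hb⟩ with hbdef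
        by_cases hi0 : (t : ℕ) % (k + 2) = 0
        · -- a `Y` layer
          have htY : t = posY b := Fin.ext (by simp only [posY_val, hbdef]; omega)
          left
          refine ⟨b, htY, ?_, ?_⟩
          · rw [htY]; exact (hG1 b).1
          · rw [htY, finRotate_posY hr, (hG1 b).2]; exact hα b
        · by_cases hik : (t : ℕ) % (k + 2) ≤ k
          · -- an `X` layer
            have hj : (t : ℕ) % (k + 2) - 1 < k := by omega
            set j : Fin k := ⟨_, hj⟩ with hjdef
            have htX : t = posX b j.castSucc :=
              Fin.ext (by simp only [posX_val, Fin.val_castSucc, hbdef, hjdef]; omega)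
            right
            refine ⟨b, j, htX, ?_⟩
            rw [htX, finRotate_posX_castSucc hr]
            exact hG2 b j
          · -- the `J` layer: contradiction with `x ∉ Jset`
            exfalso
            apply hxJ
            rw [Jset, mem_filter]
            refine ⟨mem_univ _, Or.inl ⟨b, Fin.ext ?_⟩⟩
            dsimp only
            simp only [posX_val, Fin.val_last, hbdef]; omega
      · -- an identity layer: the step is diagonal, contradiction with `x ∉ Jset`
        exfalso
        apply hxJ
        rw [Jset, mem_filter]
        refine ⟨mem_univ _, Or.inr ⟨not_lt.1 hlt, ?_⟩⟩
        dsimp only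
        rw [hG3 t (not_lt.1 hlt)]
        -- the next position is an identity position or `0 = posY 0`
        by_cases hnext : (t : ℕ) + 1 < nL r k e
        · refine (hG3 _ ?_).symm
          rw [val_finRotate_nL hr, if_pos hnext]; omega
        · have : finRotate (nL r k e) t = posY ⟨0, hr⟩ := by
            apply Fin.ext; rw [val_finRotate_nL hr, if_neg hnext, posY_val]; simp
          rw [this, (hG1 _).1]
    · -- through `α`
      rw [Lalpha, List.mem_ofFn] at hx
      obtain ⟨b, rfl⟩ := hx
      rw [support_eraseVars, mem_sdiff, mem_support_closedWalkExp_iff]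
      constructor
      · simp only [finRotate_posY hr, (hG1 b).1, (hG1 b).2]
      · rw [Jset, mem_filter, not_and_or]
        right; push Not
        exact ⟨fun b' => posY_ne_posJ b b', fun h => absurd h (not_le.2 (posY_val_lt b))⟩

/-! ### Recoverability and the count -/

/-- **An alive closed walk is determined by its non-`Jset` variables** (`r ≥ 1`): the
non-`Jset` variables cover every block position twice, and on the identity layers an alive walk
takes diagonal steps back to its start `0`. [cite: KumarSaraf2017, §8.1] -/
theorem eraseVars_injOn_aliveWalks (hr : 0 < r) (S : Fin r → Finset (Fin N))
    (ξ : Fin r → Fin k × Fin N → Finset (Fin N)) :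
    Set.InjOn (fun v : Fin (nL r k e) → Fin N => eraseVars (Jset (N := N)) (closedWalkExp v))
      (↑(aliveWalks (Jset (N := N)) (Vset (e := e) hN S ξ)) : Set (Fin (nL r k e) → Fin N)) := by
  classical
  have hd := nL_pos (k := k) (e := e) hr
  -- an alive walk takes diagonal steps on the identity layers
  have hdiag : ∀ v ∈ aliveWalks (Jset (N := N)) (Vset (k := k) (e := e) hN S ξ),
      ∀ t : Fin (nL r k e), r * (k + 2) ≤ (t : ℕ) → v t = v (finRotate _ t) := by
    intro v hv t ht
    rw [aliveWalks, mem_filter] at hv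
    by_contra hne
    have hx : ((t, v t, v (finRotate _ t)) : Fin (nL r k e) × Fin N × Fin N) ∈
        (closedWalkExp v).support \ Jset (N := N) := by
      rw [mem_sdiff, mem_support_closedWalkExp_iff]
      refine ⟨rfl, fun hJ => ?_⟩
      rw [Jset, mem_filter] at hJ
      rcases hJ.2 with ⟨b', h⟩ | ⟨-, h⟩
      · have h1 : (t : ℕ) = ((posX (e := e) b' (Fin.last k) : Fin (nL r k e)) : ℕ) := congrArg Fin.val h
        have h2 := posX_val_lt (e := e) b' (Fin.last k)
        omega
      · exact hne h
    have hV := hv.2 hx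
    rw [Vset, mem_filter] at hV
    rcases hV.2 with ⟨b', hb', -, -⟩ | ⟨b', j', hpos, -⟩
    · have h1 : (t : ℕ) = ((posY (k := k) (e := e) b' : Fin (nL r k e)) : ℕ) := congrArg Fin.val hb'
      have h2 := posY_val_lt (k := k) (e := e) b'
      omega
    · have h1 : (t : ℕ) = ((posX (e := e) b' j'.castSucc : Fin (nL r k e)) : ℕ) := congrArg Fin.val hpos
      have h2 := posX_val_lt (e := e) b' j'.castSucc
      omega
  -- agreement at the source and the target of every non-`Jset` layer
  intro v hv w hw hE
  simp only at hE
  have hagree : ∀ t : Fin (nL r k e), ((t, v t, v (finRotate _ t)) : Fin (nL r k e) × Fin N × Fin N)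
      ∉ Jset (N := N) → v t = w t ∧ v (finRotate _ t) = w (finRotate _ t) := by
    intro t hnJ
    have hx : ((t, v t, v (finRotate _ t)) : Fin (nL r k e) × Fin N × Fin N) ∈
        (eraseVars (Jset (N := N)) (closedWalkExp v)).support := by
      rw [support_eraseVars, mem_sdiff, mem_support_closedWalkExp_iff]; exact ⟨rfl, hnJ⟩
    rw [hE, support_eraseVars, mem_sdiff, mem_support_closedWalkExp_iff] at hx
    have h := hx.1
    simp only [Prod.mk.injEq, true_and] at h
    exact ⟨h.1, h.2⟩
  funext t
  by_cases hlt : (t : ℕ) < r * (k + 2)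
  · obtain ⟨hb, heq, hi⟩ := div_mod_of_lt hlt
    set b : Fin r := ⟨(t : ℕ) / (k + 2), hb⟩ with hbdef
    -- `Y` layers and `X` layers are never in `Jset`
    have hYnJ : ∀ b : Fin r, ((posY b, v (posY b), v (finRotate _ (posY b))) :
        Fin (nL r k e) × Fin N × Fin N) ∉ Jset (N := N) := by
      intro b hJ
      rw [Jset, mem_filter] at hJ
      rcases hJ.2 with ⟨b', h⟩ | ⟨h, -⟩
      · exact posY_ne_posJ b b' h
      · exact absurd h (not_le.2 (posY_val_lt b))
    have hXnJ : ∀ (b : Fin r) (j : Fin k), ((posX (e := e) b j.castSucc, v (posX b j.castSucc),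
        v (finRotate _ (posX b j.castSucc))) : Fin (nL r k e) × Fin N × Fin N) ∉ Jset (N := N) := by
      intro b j hJ
      rw [Jset, mem_filter] at hJ
      rcases hJ.2 with ⟨b', h⟩ | ⟨h, -⟩
      · exact posX_castSucc_ne_posJ b b' j h
      · exact absurd h (not_le.2 (posX_val_lt b _))
    by_cases hi0 : (t : ℕ) % (k + 2) = 0
    · have htY : t = posY b := Fin.ext (by simp only [posY_val, hbdef]; omega)
      rw [htY]; exact (hagree _ (hYnJ b)).1
    · -- position `posX b i` with `i = t % (k+2) - 1 ≤ k`: target of the previous layer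
      have hi' : (t : ℕ) % (k + 2) - 1 < k + 1 := by omega
      by_cases hi1 : (t : ℕ) % (k + 2) = 1
      · -- `posX b 0`: target of the `Y` layer
        have htX : t = posX b 0 := Fin.ext (by simp only [posX_val, hbdef, Fin.val_zero]; omega)
        rw [htX, ← finRotate_posY hr]
        exact (hagree _ (hYnJ b)).2
      · -- `posX b (j+1)`: target of `X_j`
        have hj : (t : ℕ) % (k + 2) - 2 < k := by omega
        set j : Fin k := ⟨_, hj⟩ with hjdef
        have htX : t = posX b j.succ :=
          Fin.ext (by simp only [posX_val, Fin.val_succ, hbdef, hjdef]; omega)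
        rw [htX, ← finRotate_posX_castSucc hr]
        exact (hagree _ (hXnJ b j)).2
  · -- identity positions: both walks sit at their common start
    rw [eq_of_identity_steps hr v (hdiag v (mem_coe.1 hv)) t (not_lt.1 hlt),
      eq_of_identity_steps hr w (hdiag w (mem_coe.1 hw)) t (not_lt.1 hlt)]
    have h0 : (⟨0, hd⟩ : Fin (nL r k e)) = posY ⟨0, hr⟩ := Fin.ext (by simp)
    rw [h0]
    have hYnJ : ((posY ⟨0, hr⟩, v (posY ⟨0, hr⟩), v (finRotate _ (posY ⟨0, hr⟩))) :
        Fin (nL r k e) × Fin N × Fin N) ∉ Jset (N := N) := by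
      intro hJ
      rw [Jset, mem_filter] at hJ
      rcases hJ.2 with ⟨b', h⟩ | ⟨h, -⟩
      · exact posY_ne_posJ _ b' h
      · exact absurd h (not_le.2 (posY_val_lt _))
    exact (hagree _ hYnJ).1

/-- The alive walks through `α`, as good walks: the two finite sets coincide. [cite: KumarSaraf2017, §8.1] -/
theorem derivWalks_eq_goodWalks (hr : 0 < r) (S : Fin r → Finset (Fin N))
    (ξ : Fin r → Fin k × Fin N → Finset (Fin N)) (α : Fin r → Fin N) (hα : ∀ b, α b ∈ S b) :
    derivWalks (Jset (N := N)) (Vset hN S ξ) (Lalpha hN α) = goodWalks (e := e) hN ξ α := by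
  ext v
  rw [mem_derivWalks_iff_goodWalk hN hr S ξ α hα, goodWalks, mem_filter]
  simp

/-- **Kumar–Saraf 2017, Lemma 8.3 (the count, "for all `V`")**: over a nontrivial ring, for
`r ≥ 1` blocks, a transversal `α` of kept `Y`-entries and row choices keeping `deg_j` entries in
every row of `X_j`, the support of `∂_α ρ_{J,V} IMM` has exactly `(∏_j deg_j)^r` monomials.
[cite: KumarSaraf2017, Lemma 8.3] -/
theorem card_support_deriv_immStar {K : Type*} [CommRing K] [Nontrivial K] (hr : 0 < r)
    (S : Fin r → Finset (Fin N)) (ξ : Fin r → Fin k × Fin N → Finset (Fin N)) (α : Fin r → Fin N)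
    (hα : ∀ b, α b ∈ S b) (deg : Fin k → ℕ) (hξ : ∀ b j u, (ξ b (j, u)).card = deg j) :
    (GKKS.iterPderiv (Lalpha hN α) (substVars (Jset (N := N)) (Vset hN S ξ)
      (immPoly N (nL r k e) K))).support.card = (∏ j, deg j) ^ r := by
  rw [card_support_deriv (nL_pos hr) (nodup_Lalpha hN α) (eraseVars_injOn_aliveWalks hN hr S ξ),
    derivWalks_eq_goodWalks hN hr S ξ α hα, card_goodWalks hN ξ α deg hξ]

end Literature.Computability.AlgebraicComplexity.KumarSaraf

end
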